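import Mathlib

/-!
# Resolvent smoothing of the third-order mean-flow response (solo-blind, s36; paper §24.17(7))

At finite viscosity the leaf-averaged mean-flow balance of §24.17(3),
`Ω c_H H' − ν κ₄ H'''' = −q'' Σ₁/T`, replaces the sharp third-order feedback `T₀ = β₃ ∂³`
by the resolvent-smoothed operator `T_w = ∂³ S_w`, `S_w = (1 + σ w³ ∂³)⁻¹`, `σ = ±1`.

This file records the algebraic skeleton of §24.17(7)(a),(e):

* `resolvent_deriv_identity` : in any real algebra, if `u` is a right inverse of `1 + c • d`
  then `d * u = c⁻¹ • (1 - u)` — i.e. `∂³ S_w = (σ/w³)(1 − S_w)`: the smoothed third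
  derivative is a LOCAL multiple of the identity minus a smoothing part.
* `resSymbolRe/Im` and `resSymbol_eq` : the Fourier symbol `(ik)³ / (1 − iσ w³ k³)` of `T_w`
  has real part `σ w³ k⁶/(1 + w⁶ k⁶)` and imaginary part `−k³/(1 + w⁶ k⁶)` (for `σ² = 1`).
* `resSymbolRe_eq_local_sub` : `Re = σ/w³ − σ/(w³ (1 + w⁶ k⁶))` — the local (Stokes) limit `σ/w³`.
* `resSymbolRe_nonneg` / `resSymbolRe_le` : for `σ = 1` ("Thomas–Fermi class") the symmetric
  part is positive semidefinite and bounded by `1/w³`; for `σ = −1` it is `≤ 0` ("focusing class").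

No analysis (no operators on function spaces) is formalised here; these are the pointwise /
ring-level identities the matched-asymptotics argument of §24.17(7) rests on.
-/

namespace Summit.AnomalousDissipation.AnomalousDissipation.Theorems

open Complex

/-- `∂³ S = c⁻¹ (1 − S)` whenever `S` is a right inverse of `1 + c ∂³` (`c = σ w³ ≠ 0`). -/
theorem resolvent_deriv_identity {R : Type*} [Ring R] [Algebra ℝ R]
    (c : ℝ) (hc : c ≠ 0) (d u : R) (h : (1 + c • d) * u = 1) :
    d * u = c⁻¹ • (1 - u) := by
  have h1 : c • (d * u) = 1 - u := by
    rw [add_mul, one_mul, smul_mul_assoc] at h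
    exact eq_sub_of_add_eq' h
  calc d * u = c⁻¹ • (c • (d * u)) := by rw [smul_smul, inv_mul_cancel₀ hc, one_smul]
    _ = c⁻¹ • (1 - u) := by rw [h1]

/-- The same identity with `S` a left inverse. -/
theorem resolvent_deriv_identity' {R : Type*} [Ring R] [Algebra ℝ R]
    (c : ℝ) (hc : c ≠ 0) (d u : R) (h : u * (1 + c • d) = 1) :
    u * d = c⁻¹ • (1 - u) := by
  have h1 : c • (u * d) = 1 - u := by
    rw [mul_add, mul_one, mul_smul_comm] at h
    exact eq_sub_of_add_eq' h
  calc u * d = c⁻¹ • (c • (u * d)) := by rw [smul_smul, inv_mul_cancel₀ hc, one_smul]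
    _ = c⁻¹ • (1 - u) := by rw [h1]

/-- Real part of the symbol `(ik)³/(1 − iσ w³ k³)`. -/
noncomputable def resSymbolRe (σ w k : ℝ) : ℝ := σ * w ^ 3 * k ^ 6 / (1 + w ^ 6 * k ^ 6)

/-- Imaginary part of the symbol `(ik)³/(1 − iσ w³ k³)`. -/
noncomputable def resSymbolIm (w k : ℝ) : ℝ := -k ^ 3 / (1 + w ^ 6 * k ^ 6)

/-- The common denominator `1 + w⁶ k⁶` of the resolvent symbol is positive. -/
theorem one_add_pow_six_pos (w k : ℝ) : 0 < 1 + w ^ 6 * k ^ 6 := by positivity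

/-- The symbol identity: `(ik)³ = (Re + i Im)·(1 − iσ w³ k³)` for `σ² = 1`, i.e.
`(ik)³/(1 − iσ w³k³) = Re + i Im`. Stated multiplicatively (no complex division). -/
theorem resSymbol_eq (σ w k : ℝ) (hσ : σ ^ 2 = 1) :
    (I * k) ^ 3 = (⟨resSymbolRe σ w k, resSymbolIm w k⟩ : ℂ) * (1 - I * σ * w ^ 3 * k ^ 3) := by
  have hD : (1 + w ^ 6 * k ^ 6) ≠ 0 := (one_add_pow_six_pos w k).ne'
  apply Complex.ext
  · simp only [resSymbolRe, resSymbolIm, mul_re, mul_im, sub_re, sub_im, one_re, one_im, I_re, I_im,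
      ofReal_re, ofReal_im, pow_succ, pow_zero, one_mul, mul_one, mul_zero, zero_mul, sub_zero,
      zero_sub, add_zero, zero_add]
    field_simp
    ring
  · simp only [resSymbolRe, resSymbolIm, mul_re, mul_im, sub_re, sub_im, one_re, one_im, I_re, I_im,
      ofReal_re, ofReal_im, pow_succ, pow_zero, one_mul, mul_one, mul_zero, zero_mul, sub_zero,
      zero_sub, add_zero, zero_add]
    field_simp
    linear_combination (k ^ 9 * w ^ 6) * hσ

/-- The local (Stokes) limit made exact: `Re = σ/w³ − σ/(w³(1 + w⁶k⁶))`. -/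
theorem resSymbolRe_eq_local_sub (σ w k : ℝ) (hw : w ≠ 0) :
    resSymbolRe σ w k = σ / w ^ 3 - σ / (w ^ 3 * (1 + w ^ 6 * k ^ 6)) := by
  have hD : (1 + w ^ 6 * k ^ 6) ≠ 0 := (one_add_pow_six_pos w k).ne'
  have hw3 : w ^ 3 ≠ 0 := pow_ne_zero 3 hw
  unfold resSymbolRe
  field_simp
  ring

/-- Thomas–Fermi class (`σ = 1`): the symmetric part of the symbol is nonnegative … -/
theorem resSymbolRe_nonneg (w k : ℝ) (hw : 0 ≤ w) : 0 ≤ resSymbolRe 1 w k := by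
  unfold resSymbolRe
  apply div_nonneg _ (one_add_pow_six_pos w k).le
  have : 0 ≤ k ^ 6 := by positivity
  have : 0 ≤ w ^ 3 := by positivity
  positivity

/-- … vanishes only at `k = 0` (for `w > 0`) … -/
theorem resSymbolRe_pos (w k : ℝ) (hw : 0 < w) (hk : k ≠ 0) : 0 < resSymbolRe 1 w k := by
  unfold resSymbolRe
  apply div_pos _ (one_add_pow_six_pos w k)
  have : 0 < k ^ 6 := by positivity
  have : 0 < w ^ 3 := by positivity
  positivity

/-- … and is bounded by the local coefficient `1/w³`. -/
theorem resSymbolRe_le (w k : ℝ) (hw : 0 < w) : resSymbolRe 1 w k ≤ 1 / w ^ 3 := by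
  rw [resSymbolRe_eq_local_sub 1 w k hw.ne']
  have : 0 < w ^ 3 * (1 + w ^ 6 * k ^ 6) := mul_pos (pow_pos hw 3) (one_add_pow_six_pos w k)
  have : 0 ≤ 1 / (w ^ 3 * (1 + w ^ 6 * k ^ 6)) := by positivity
  linarith

/-- Focusing class (`σ = −1`): the symmetric part is nonpositive. -/
theorem resSymbolRe_nonpos_focusing (w k : ℝ) (hw : 0 ≤ w) : resSymbolRe (-1) w k ≤ 0 := by
  have h := resSymbolRe_nonneg w k hw
  unfold resSymbolRe at *
  have hD := one_add_pow_six_pos w k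
  rw [div_le_iff₀ hD]; rw [le_div_iff₀ hD] at h
  linarith

/-- The odd (dispersive) part is class-independent and decays beyond `k ~ 1/w`:
`|Im| ≤ |k|³` with equality structure `Im = −k³/(1 + w⁶k⁶)`. -/
theorem resSymbolIm_abs_le (w k : ℝ) : |resSymbolIm w k| ≤ |k| ^ 3 := by
  unfold resSymbolIm
  rw [abs_div, abs_neg, abs_of_pos (one_add_pow_six_pos w k), ← abs_pow]
  apply div_le_self (abs_nonneg _)
  have : 0 ≤ w ^ 6 * k ^ 6 := by positivity
  linarith

end Summit.AnomalousDissipation.AnomalousDissipation.Theorems
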